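import Summits.Ventures.PercRepro.GenQSolidDemandFree
import Summits.Ventures.PercRepro.GenQFlatFacts
import Summits.Ventures.PercRepro.GenQFlatLatticeA
import Summits.Ventures.PercRepro.GenQHyperplaneRowsB

/-!
# PercRepro — the flat-lattice counting rows, part H: the `j`-subsets by rank above the plane bound, at rank `6`
(night-4, gen 11)

With lines `≤ 3` and planes `≤ 6` points, a subset of `≥ 7` points has rank `≥ 4`, and every `j`-subset (`j ≥ 7`) of
a solid trace has rank exactly `4`; so the `j`-subsets of a rank-`6` set `G` are the spanning ones, the bases-like
rank-`5` ones (`SP_{s,j}`) and the `j`-subsets of the solid traces, exactly: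

`C(n, j) = Σ_m #Pc (n−j) m + Σ_s SP_{s,j} + Σ_s C(s, j)·NR 4 s`   (`ga_eq_row`, `7 ≤ j ≤ n`)

— the row (G-A) of the two-level profile LP in its EQUALITY form at `q = 6` (sheet §65 (b)).  Imports
`GenQSolidDemandFree`, `GenQFlatFacts`, `GenQFlatLatticeA`, `GenQHyperplaneRowsB`.
-/
namespace PercRepro.Night4

open Finset ThmH SixFour GenQ PerFlat Star

variable {α : Type*} [DecidableEq α] {M : Matroid α} [M.Finite]

/-- A set of `≥ 7` points of `G` has rank `≥ 4` (lines `≤ 3`, planes `≤ 6`). -/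
theorem four_le_eRk_of_seven_le (hs : Simple M) (hline : ∀ L ∈ flatsQ M 2, L.card ≤ 3)
    (hplane : ∀ P ∈ flatsQ M 3, P.card ≤ 6) {G A : Finset α} (hG : G ⊆ gr M) (hA : A ⊆ G) (h7 : 7 ≤ A.card) :
    ((4 : ℕ) : ℕ∞) ≤ M.eRk (A : Set α) := by
  obtain ⟨a, ha⟩ := exists_eRk_eq_nat (M := M) A
  rw [ha]
  by_contra hlt
  have ha3 : a ≤ 3 := by
    have : (a : ℕ∞) < ((4 : ℕ) : ℕ∞) := not_le.1 hlt
    have h' : a < 4 := by exact_mod_cast this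
    omega
  have hflat : clF M A ∈ flatsQ M a := by
    rw [mem_flatsQ, ← Finset.coe_subset, coe_clF, coe_gr]
    exact ⟨M.closure_subset_ground _, M.isFlat_closure _, by rw [M.eRk_closure_eq, ha]⟩
  have hAcl : A ⊆ clF M A := by
    intro y hy
    rw [mem_clF]
    refine M.subset_closure _ ?_ (Finset.mem_coe.2 hy)
    rw [← coe_gr M]
    exact Finset.coe_subset.2 (hA.trans hG)
  have hcard := Finset.card_le_card hAcl
  rcases Nat.lt_or_ge a 2 with h1 | h2
  · have := card_le_one_of_flatsQ_le_one hs (by omega : a ≤ 1) hflat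
    omega
  · rcases Nat.lt_or_ge a 3 with h3 | h4
    · have ha2 : a = 2 := by omega
      rw [ha2] at hflat
      have := hline _ hflat
      omega
    · have ha3' : a = 3 := by omega
      rw [ha3'] at hflat
      have := hplane _ hflat
      omega

/-- A `j`-subset (`j ≥ 7`) of a solid trace has rank exactly `4`. -/
theorem eRk_eq_four_of_subset_solid (hs : Simple M) (hline : ∀ L ∈ flatsQ M 2, L.card ≤ 3)
    (hplane : ∀ P ∈ flatsQ M 3, P.card ≤ 6) {G F A : Finset α} (hG : G ⊆ gr M) (hF : F ∈ flatsQ M 4)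
    (hA : A ⊆ F ∩ G) (h7 : 7 ≤ A.card) : M.eRk (A : Set α) = ((4 : ℕ) : ℕ∞) := by
  have hF' := mem_flatsQ.1 hF
  refine le_antisymm ?_ (four_le_eRk_of_seven_le hs hline hplane hG (hA.trans Finset.inter_subset_right) h7)
  rw [← hF'.2.2]
  exact M.eRk_mono (Finset.coe_subset.2 (hA.trans Finset.inter_subset_left))

/-- **(G-A), the equality form at `q = 6`, `j ≥ 7`**:
`C(n, j) = Σ_m #Pc (n−j) m + Σ_s SP_{s,j} + Σ_s C(s, j)·NR 4 s`. -/
theorem ga_eq_row (hs : Simple M) (hline : ∀ L ∈ flatsQ M 2, L.card ≤ 3) (hplane : ∀ P ∈ flatsQ M 3, P.card ≤ 6)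
    {G : Finset α} (hG : G ⊆ gr M) (hrG : M.eRk (G : Set α) = ((6 : ℕ) : ℕ∞)) {j : ℕ} (h7 : 7 ≤ j)
    (hj : j ≤ G.card) :
    G.card.choose j = ∑ m ∈ Finset.Icc (mTr M G) 6, (Pc M G 6 (G.card - j) m).card
      + ∑ s ∈ Finset.range (G.card + 1), spSum M G 5 s j
      + ∑ s ∈ Finset.range (G.card + 1), s.choose j * NR M G 4 s := by
  classical
  rw [choose_eq_sum_card_rank_subsets hrG j]
  -- ranks `0 … 3` are empty for `j ≥ 7`
  have hzero : ∀ ρ ∈ Finset.range 4,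
      ((G.powersetCard j).filter (fun T : Finset α => M.eRk (T : Set α) = (ρ : ℕ∞))).card = 0 := by
    intro ρ hρ
    rw [Finset.mem_range] at hρ
    rw [Finset.card_eq_zero, Finset.filter_eq_empty_iff]
    intro T hT hTr
    rw [Finset.mem_powersetCard] at hT
    have h4 := four_le_eRk_of_seven_le hs hline hplane hG hT.1 (by omega)
    rw [hTr] at h4
    have : 4 ≤ ρ := by exact_mod_cast h4
    omega
  have hsplit : ∑ ρ ∈ Finset.range (6 + 1),
      ((G.powersetCard j).filter (fun T : Finset α => M.eRk (T : Set α) = (ρ : ℕ∞))).card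
      = ((G.powersetCard j).filter (fun T : Finset α => M.eRk (T : Set α) = ((6 : ℕ) : ℕ∞))).card
        + ((G.powersetCard j).filter (fun T : Finset α => M.eRk (T : Set α) = ((5 : ℕ) : ℕ∞))).card
        + ((G.powersetCard j).filter (fun T : Finset α => M.eRk (T : Set α) = ((4 : ℕ) : ℕ∞))).card := by
    simp only [Finset.sum_range_succ, Finset.sum_range_zero]
    have h0 := hzero 0 (by simp); have h1 := hzero 1 (by simp)
    have h2 := hzero 2 (by simp); have h3 := hzero 3 (by simp)
    push_cast at h0 h1 h2 h3 ⊢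
    omega
  rw [hsplit, card_rank_q_subsets_eq_sum_Pc hG hrG hj, h2_row hG 5 j, card_rank_eq_eq_sum_flats hG j 4]
  congr 1
  -- the solids: every `j`-subset of a solid trace has rank `4`
  have hfib : ∑ s ∈ Finset.range (G.card + 1), s.choose j * NR M G 4 s
      = ∑ F ∈ flatsQ M 4, (F ∩ G).card.choose j := by
    unfold NR
    rw [← Finset.sum_fiberwise_of_maps_to (s := flatsQ M 4) (t := Finset.range (G.card + 1))
      (g := fun F : Finset α => (F ∩ G).card) (fun F _ => Finset.mem_coe.2 (Finset.mem_range.2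
        (Nat.lt_succ_of_le (Finset.card_le_card Finset.inter_subset_right))))]
    refine Finset.sum_congr rfl (fun s _ => ?_)
    rw [Finset.card_eq_sum_ones, Finset.mul_sum, mul_one]
    refine Finset.sum_congr rfl (fun F hF => ?_)
    rw [(Finset.mem_filter.1 hF).2]
  rw [hfib]
  refine Finset.sum_congr rfl (fun F hF => ?_)
  rw [← Finset.card_powersetCard]
  rw [Finset.card_filter_eq_iff]
  intro A hA
  rw [Finset.mem_powersetCard] at hA
  exact eRk_eq_four_of_subset_solid hs hline hplane hG hF hA.1 (by omega)

end PercRepro.Night4
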